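import Summits.ValiantsHypothesis.ValiantsHypothesis.Theorems.GrenetZeonDualUnipotentThreeHalvesHeavyTopCodimOneHullForm
import Summits.ValiantsHypothesis.ValiantsHypothesis.Theorems.GrenetZeonDualUnipotentThreeHalvesHeavyTopCodimOneFibres
import Summits.ValiantsHypothesis.ValiantsHypothesis.Theorems.GrenetZeonDualUnipotentThreeHalvesHeavyTopTowerEmbedding
import Summits.ValiantsHypothesis.ValiantsHypothesis.Theorems.GrenetZeonDualUnipotentThreeHalvesHeavyTopTowerBase

/-!
# `GrenetZeon.DualUnipotentThreeHalves` (stmt-ValiantsHypothesis-24318), R2 heavy-top instrument — COROLLARY II of val-idea-30's codim-one memo, KERNEL: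
# a nilpotent space of `m × m` matrices of dimension `C(m,2) − 1` is triangularisable or a TOWER `T(p, I, q)`

**Theorem (val-idea-30 MEMO codim-one rev 1.2 §0 COROLLARY II; critic val-idea-crit-7 g7 row r31).**  Let `m ≥ 2` and let `V ≤ M_m(ℂ)` be a linear space
of nilpotent matrices with `dim V = C(m,2) − 1`.  Then EITHER `V` is conjugate into `𝔫_m` (a hyperplane of a maximal nilpotent algebra), OR there are
`p, q` with a re-indexing `e : Fin m ≃ Fin (p + 3 + q)`, an IRREDUCIBLE nilpotent PLANE `I ≤ M₃(ℂ)` and a unit `P` with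
`A ∈ V ↔ reindex e e (P A P⁻¹) ∈ towerHull p q I` — `V` is conjugate ONTO the tower `T(p, I, q) = HULL(𝔫_p, I, 𝔫_q)` (✓ `…HeavyTopTowerDefs`;
nilpotent, of dimension `C(m,2) − 1`, not triangularisable: ✓ `…HeavyTopTowerLemmas`, `…HeavyTopTowerDimension`).  At `m = 2, 3` the content is
`V = ⊥` / `V` a hyperplane of `𝔫₃` or `V = I` (`p = q = 0`).  No uniqueness of `(p, q, I)` is claimed.

Proof: ✓ `codimOne_hull_form_units` (composition chain ✓ `exists_block_conj`, deficiency count ✓ `levels_of_deficiency_le_one`, cases ✓ `…Pattern` /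
✓ `…Hull`, Gerstenhaber equality on the outer blocks) followed by the coordinate bookkeeping of this file: the fibre re-indexing ✓ `exists_fibre_equiv`,
the block-diagonal unit `diag(Q₂, 1, Q₀)` in `Fin a₂ ⊕ (Fin 3 ⊕ Fin a₀)` coordinates, and the re-embedding lemmas ✓ R/L of `…HeavyTopTowerEmbedding` with
✓ `…HeavyTopTowerBase` (hence `p = a₂ + 0`, `q = 0 + a₀` literally).

* `reindex_sumCongr_fromBlocks`, `reindex_trans_eq`, `blockDiag_conj` — bookkeeping;
* ★ `codimOne_classification` — the theorem.

Honest framing: a classification of extremal nilpotent subspaces feeding the census instrument (EXTREMISERS X15); nothing here proves or refutes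
`HeavyTopLaw`, 24318, S3b or 8062; `VP ≠ VNP` is NOT proved.  No definitions.
[val-idea-30 MEMO codim-one rev 1.2 §0 COROLLARY II / §4; cell val-heavytop-census, eng-1 g5]
-/

noncomputable section

-- single-conjunct layout: Sub = Summit, duplicated namespace component intended
set_option linter.dupNamespace false

namespace Summit.ValiantsHypothesis.ValiantsHypothesis.Theorems.GrenetZeon.HeavyTopCodimOneClassification

open Matrix
open Summit.ValiantsHypothesis.ValiantsHypothesis.Theorems.GrenetZeon.HeavyTopTowerDefs (towerHull)
open Summit.ValiantsHypothesis.ValiantsHypothesis.Theorems.GrenetZeon.HeavyTopCodimOneHullForm (codimOne_hull_form_units)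
open Summit.ValiantsHypothesis.ValiantsHypothesis.Theorems.GrenetZeon.HeavyTopCodimOneFibres (exists_fibre_equiv)
open Summit.ValiantsHypothesis.ValiantsHypothesis.Theorems.GrenetZeon.HeavyTopTowerEmbedding (reindex_fromBlocks_mem_towerHull_iff
  reindex_fromBlocks_mem_towerHull_iff_left)
open Summit.ValiantsHypothesis.ValiantsHypothesis.Theorems.GrenetZeon.HeavyTopTowerBase (mem_towerHull_zero_zero midBlock_zero_zero_reindex)
open Literature.LinearAlgebra.Matrix (IsStrictUpper)

/-! ## Bookkeeping -/

/-- Re-indexing a block matrix along a sum of equivalences re-indexes the blocks. -/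
theorem reindex_sumCongr_fromBlocks {α β γ δ α' β' γ' δ' : Type*} (ea : α ≃ α') (eb : β ≃ β') (ec : γ ≃ γ') (ed : δ ≃ δ')
    (A : Matrix α γ ℂ) (B : Matrix α δ ℂ) (C : Matrix β γ ℂ) (D : Matrix β δ ℂ) :
    Matrix.reindex (ea.sumCongr eb) (ec.sumCongr ed) (Matrix.fromBlocks A B C D) =
      Matrix.fromBlocks (Matrix.reindex ea ec A) (Matrix.reindex ea ed B) (Matrix.reindex eb ec C) (Matrix.reindex eb ed D) := by
  ext (i | i) (j | j) <;> rfl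

/-- Re-indexing along a composite. -/
theorem reindex_trans_eq {α β γ : Type*} (e : α ≃ β) (f : β ≃ γ) (N : Matrix α α ℂ) :
    Matrix.reindex (e.trans f) (e.trans f) N = Matrix.reindex f f (Matrix.reindex e e N) := by
  ext i j; rfl

/-- Conjugating a block matrix by block-diagonal matrices. -/
theorem blockDiag_conj {α β : Type*} [Fintype α] [Fintype β] [DecidableEq α] [DecidableEq β]
    (Qa Qa' : Matrix α α ℂ) (Qb Qb' : Matrix β β ℂ) (A : Matrix α α ℂ) (B : Matrix α β ℂ) (C : Matrix β α ℂ) (D : Matrix β β ℂ) :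
    Matrix.fromBlocks Qa 0 0 Qb * Matrix.fromBlocks A B C D * Matrix.fromBlocks Qa' 0 0 Qb' =
      Matrix.fromBlocks (Qa * A * Qa') (Qa * B * Qb') (Qb * C * Qa') (Qb * D * Qb') := by
  rw [Matrix.fromBlocks_multiply, Matrix.fromBlocks_multiply]
  simp only [Matrix.zero_mul, Matrix.mul_zero, add_zero, zero_add]

/-! ## ★ COROLLARY II -/

/-- ★ **COROLLARY II (val-idea-30 MEMO codim-one): the codimension-one nilpotent spaces are the hyperplanes of `𝔫_m` and the towers `T(p, I, q)`,
up to conjugacy.**  For `m ≥ 2` and `V ≤ M_m(ℂ)` nilpotent with `dim V = C(m,2) − 1`: `V` is conjugate into the strictly upper triangular matrices, or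
conjugate (after a re-indexing `Fin m ≃ Fin (p+3+q)`) ONTO `towerHull p q I` for an irreducible nilpotent plane `I ≤ M₃(ℂ)`.
[val-idea-30 MEMO codim-one rev 1.2 §0 COROLLARY II; composition-chain proof, this cell] -/
theorem codimOne_classification {m : ℕ} (hm : 2 ≤ m) (V : Submodule ℂ (Matrix (Fin m) (Fin m) ℂ)) (hV : ∀ A ∈ V, IsNilpotent A)
    (hdim : Module.finrank ℂ V = m.choose 2 - 1) :
    (∃ P : Matrix (Fin m) (Fin m) ℂ, IsUnit P ∧ ∀ A ∈ V, IsStrictUpper (P * A * P⁻¹)) ∨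
    (∃ (p q : ℕ) (e : Fin m ≃ Fin (p + 3 + q)) (I : Submodule ℂ (Matrix (Fin 3) (Fin 3) ℂ)) (P : Matrix (Fin m) (Fin m) ℂ),
      IsUnit P ∧ Module.finrank ℂ I = 2 ∧ (∀ X ∈ I, IsNilpotent X) ∧
      (∀ U : Submodule ℂ (Fin 3 → ℂ), (∀ X ∈ I, ∀ x ∈ U, X *ᵥ x ∈ U) → U = ⊥ ∨ U = ⊤) ∧
      ∀ A, A ∈ V ↔ Matrix.reindex e e (P * A * P⁻¹) ∈ towerHull p q I) := by
  classical
  have h1 : 1 ≤ m.choose 2 := by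
    have := Nat.choose_le_choose 2 hm
    rwa [show (2 : ℕ).choose 2 = 1 from rfl] at this
  have hdim' : Module.finrank ℂ V + 1 = m.choose 2 := by omega
  rcases codimOne_hull_form_units V hV hdim' with h | ⟨P, c, a₀, a₂, e₀, e₁, e₂, Q₀, I, Q₂, hP, hc, hQ₀, hQ₂, hIn, hId, hIirr, hmem⟩
  · exact Or.inl h
  right
  obtain ⟨F, hFs2, hFs1, hFs0, hF2, hF1, hF0, hc2, hc1, hc0⟩ := exists_fibre_equiv c hc e₀ e₁ e₂
  have hQ₀det : IsUnit Q₀.det := (Matrix.isUnit_iff_isUnit_det Q₀).1 hQ₀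
  have hQ₂det : IsUnit Q₂.det := (Matrix.isUnit_iff_isUnit_det Q₂).1 hQ₂
  -- the block-diagonal unit `diag(Q₂, 1, Q₀)` in `Fin a₂ ⊕ (Fin 3 ⊕ Fin a₀)` coordinates, and back on `Fin m`
  have hEE : Matrix.fromBlocks (1 : Matrix (Fin 3) (Fin 3) ℂ) 0 0 Q₀ * Matrix.fromBlocks 1 0 0 Q₀⁻¹ = 1 := by
    rw [Matrix.fromBlocks_multiply]
    simp only [Matrix.mul_zero, Matrix.zero_mul, add_zero, zero_add, Matrix.mul_one, Matrix.mul_nonsing_inv _ hQ₀det, Matrix.fromBlocks_one]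
  have hE'E : Matrix.fromBlocks (1 : Matrix (Fin 3) (Fin 3) ℂ) 0 0 Q₀⁻¹ * Matrix.fromBlocks 1 0 0 Q₀ = 1 := by
    rw [Matrix.fromBlocks_multiply]
    simp only [Matrix.mul_zero, Matrix.zero_mul, add_zero, zero_add, Matrix.mul_one, Matrix.nonsing_inv_mul _ hQ₀det, Matrix.fromBlocks_one]
  have hDD : Matrix.fromBlocks Q₂ 0 0 (Matrix.fromBlocks (1 : Matrix (Fin 3) (Fin 3) ℂ) 0 0 Q₀) *
      Matrix.fromBlocks Q₂⁻¹ 0 0 (Matrix.fromBlocks (1 : Matrix (Fin 3) (Fin 3) ℂ) 0 0 Q₀⁻¹) = 1 := by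
    rw [Matrix.fromBlocks_multiply]
    simp only [Matrix.mul_zero, Matrix.zero_mul, add_zero, zero_add, Matrix.mul_nonsing_inv _ hQ₂det, hEE, Matrix.fromBlocks_one]
  set D : Matrix (Fin m) (Fin m) ℂ :=
    Matrix.reindex F.symm F.symm (Matrix.fromBlocks Q₂ 0 0 (Matrix.fromBlocks (1 : Matrix (Fin 3) (Fin 3) ℂ) 0 0 Q₀)) with hD
  set Di : Matrix (Fin m) (Fin m) ℂ :=
    Matrix.reindex F.symm F.symm (Matrix.fromBlocks Q₂⁻¹ 0 0 (Matrix.fromBlocks (1 : Matrix (Fin 3) (Fin 3) ℂ) 0 0 Q₀⁻¹)) with hDi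
  have hDDi : D * Di = 1 := by
    rw [hD, hDi, Matrix.reindex_apply, Matrix.reindex_apply, Equiv.symm_symm, Matrix.submatrix_mul_equiv, hDD, Matrix.submatrix_one_equiv]
  have hDunit : IsUnit D := by
    have h := congrArg Matrix.det hDDi
    rw [Matrix.det_mul, Matrix.det_one] at h
    exact (Matrix.isUnit_iff_isUnit_det D).2 (IsUnit.of_mul_eq_one _ h)
  have hDinv : D⁻¹ = Di := Matrix.inv_eq_right_inv hDDi
  have hFD : Matrix.reindex F F D = Matrix.fromBlocks Q₂ 0 0 (Matrix.fromBlocks (1 : Matrix (Fin 3) (Fin 3) ℂ) 0 0 Q₀) := by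
    rw [hD]; ext i j; simp [Matrix.reindex_apply]
  have hFDi : Matrix.reindex F F Di = Matrix.fromBlocks Q₂⁻¹ 0 0 (Matrix.fromBlocks (1 : Matrix (Fin 3) (Fin 3) ℂ) 0 0 Q₀⁻¹) := by
    rw [hDi]; ext i j; simp [Matrix.reindex_apply]
  -- the total re-indexing `Fin m ≃ Fin (a₂ + 0 + 3 + (0 + a₀))`
  have h3 : 3 = 0 + 3 + 0 := by norm_num
  have hL : a₂ + (0 + 3 + (0 + a₀)) = a₂ + 0 + 3 + (0 + a₀) := by omega
  let eR : Fin (0 + 3 + 0) ⊕ Fin a₀ ≃ Fin (0 + 3 + (0 + a₀)) := finSumFinEquiv.trans (finCongr (Nat.add_assoc (0 + 3) 0 a₀))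
  let G₂ : Fin 3 ⊕ Fin a₀ ≃ Fin (0 + 3 + (0 + a₀)) := ((finCongr h3).sumCongr (Equiv.refl (Fin a₀))).trans eR
  let eL : Fin a₂ ⊕ Fin (0 + 3 + (0 + a₀)) ≃ Fin (a₂ + 0 + 3 + (0 + a₀)) := finSumFinEquiv.trans (finCongr hL)
  let G : Fin a₂ ⊕ (Fin 3 ⊕ Fin a₀) ≃ Fin (a₂ + 0 + 3 + (0 + a₀)) := ((Equiv.refl (Fin a₂)).sumCongr G₂).trans eL
  refine ⟨a₂ + 0, 0 + a₀, F.trans G, I, D * P, hDunit.mul hP, hId, hIn, hIirr, fun A => ?_⟩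
  rw [hmem A]
  -- the conjugate in sum coordinates
  set M : Matrix (Fin m) (Fin m) ℂ := P * A * P⁻¹ with hM
  set X : Matrix (Fin a₂ ⊕ (Fin 3 ⊕ Fin a₀)) (Fin a₂ ⊕ (Fin 3 ⊕ Fin a₀)) ℂ := Matrix.reindex F F M with hX
  have hconj : D * P * A * (D * P)⁻¹ = D * M * Di := by
    rw [Matrix.mul_inv_rev, hDinv, hM]; simp only [Matrix.mul_assoc]
  have hFconj : Matrix.reindex F F (D * M * Di) =
      Matrix.fromBlocks Q₂ 0 0 (Matrix.fromBlocks (1 : Matrix (Fin 3) (Fin 3) ℂ) 0 0 Q₀) * X *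
        Matrix.fromBlocks Q₂⁻¹ 0 0 (Matrix.fromBlocks (1 : Matrix (Fin 3) (Fin 3) ℂ) 0 0 Q₀⁻¹) := by
    rw [← hFD, ← hFDi, hX]
    simp only [Matrix.reindex_apply, Matrix.submatrix_mul_equiv]
  -- blocks of `X`
  set X₁₁ : Matrix (Fin a₂) (Fin a₂) ℂ := X.toBlocks₁₁ with hX₁₁
  set X₁₂ : Matrix (Fin a₂) (Fin 3 ⊕ Fin a₀) ℂ := X.toBlocks₁₂ with hX₁₂
  set X₂₁ : Matrix (Fin 3 ⊕ Fin a₀) (Fin a₂) ℂ := X.toBlocks₂₁ with hX₂₁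
  set X₂₂ : Matrix (Fin 3 ⊕ Fin a₀) (Fin 3 ⊕ Fin a₀) ℂ := X.toBlocks₂₂ with hX₂₂
  set Y₁₁ : Matrix (Fin 3) (Fin 3) ℂ := X₂₂.toBlocks₁₁ with hY₁₁
  set Y₁₂ : Matrix (Fin 3) (Fin a₀) ℂ := X₂₂.toBlocks₁₂ with hY₁₂
  set Y₂₁ : Matrix (Fin a₀) (Fin 3) ℂ := X₂₂.toBlocks₂₁ with hY₂₁
  set Y₂₂ : Matrix (Fin a₀) (Fin a₀) ℂ := X₂₂.toBlocks₂₂ with hY₂₂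
  have hXb : X = Matrix.fromBlocks X₁₁ X₁₂ X₂₁ (Matrix.fromBlocks Y₁₁ Y₁₂ Y₂₁ Y₂₂) := by
    rw [hY₁₁, hY₁₂, hY₂₁, hY₂₂, Matrix.fromBlocks_toBlocks, hX₁₁, hX₁₂, hX₂₁, hX₂₂, Matrix.fromBlocks_toBlocks]
  -- identification of the diagonal blocks with the fibre blocks of `M`
  have hX₁₁e : X₁₁ = Matrix.reindex e₂ e₂ (M.toBlock (fun i => c i = 2) (fun i => c i = 2)) := by
    ext x x'
    rw [hX₁₁, Matrix.toBlocks₁₁, Matrix.of_apply, hX, Matrix.reindex_apply, Matrix.submatrix_apply, hFs2, hFs2, Matrix.reindex_apply,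
      Matrix.submatrix_apply, Matrix.toBlock_apply]
  have hY₁₁e : Y₁₁ = Matrix.reindex e₁ e₁ (M.toBlock (fun i => c i = 1) (fun i => c i = 1)) := by
    ext y y'
    rw [hY₁₁, Matrix.toBlocks₁₁, Matrix.of_apply, hX₂₂, Matrix.toBlocks₂₂, Matrix.of_apply, hX, Matrix.reindex_apply, Matrix.submatrix_apply,
      hFs1, hFs1, Matrix.reindex_apply, Matrix.submatrix_apply, Matrix.toBlock_apply]
  have hY₂₂e : Y₂₂ = Matrix.reindex e₀ e₀ (M.toBlock (fun i => c i = 0) (fun i => c i = 0)) := by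
    ext z z'
    rw [hY₂₂, Matrix.toBlocks₂₂, Matrix.of_apply, hX₂₂, Matrix.toBlocks₂₂, Matrix.of_apply, hX, Matrix.reindex_apply, Matrix.submatrix_apply,
      hFs0, hFs0, Matrix.reindex_apply, Matrix.submatrix_apply, Matrix.toBlock_apply]
  -- block upper-triangularity ↔ vanishing of the lower blocks
  have hlow : (∀ i j, c i < c j → M i j = 0) ↔ X₂₁ = 0 ∧ Y₂₁ = 0 := by
    constructor
    · intro h
      refine ⟨?_, ?_⟩
      · ext (y | z) x
        · rw [hX₂₁, Matrix.toBlocks₂₁, Matrix.of_apply, hX, Matrix.reindex_apply, Matrix.submatrix_apply, Matrix.zero_apply]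
          exact h _ _ (by rw [hc1, hc2]; norm_num)
        · rw [hX₂₁, Matrix.toBlocks₂₁, Matrix.of_apply, hX, Matrix.reindex_apply, Matrix.submatrix_apply, Matrix.zero_apply]
          exact h _ _ (by rw [hc0, hc2]; norm_num)
      · ext z y
        rw [hY₂₁, Matrix.toBlocks₂₁, Matrix.of_apply, hX₂₂, Matrix.toBlocks₂₂, Matrix.of_apply, hX, Matrix.reindex_apply, Matrix.submatrix_apply,
          Matrix.zero_apply]
        exact h _ _ (by rw [hc0, hc1]; norm_num)
    · rintro ⟨hX0, hY0⟩ i j hij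
      have hi := hc i
      have hj := hc j
      have key : M i j = X (F i) (F j) := by rw [hX, Matrix.reindex_apply, Matrix.submatrix_apply, Equiv.symm_apply_apply, Equiv.symm_apply_apply]
      rw [key]
      obtain hi0 | hi1 : c i = 0 ∨ c i = 1 := by omega
      · obtain hj1 | hj2 : c j = 1 ∨ c j = 2 := by omega
        · rw [hF0 i hi0, hF1 j hj1]
          have := congrFun (congrFun hY0 (e₀ ⟨i, hi0⟩)) (e₁ ⟨j, hj1⟩)
          rwa [hY₂₁, Matrix.toBlocks₂₁, Matrix.of_apply, hX₂₂, Matrix.toBlocks₂₂, Matrix.of_apply] at this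
        · rw [hF0 i hi0, hF2 j hj2]
          have := congrFun (congrFun hX0 (Sum.inr (e₀ ⟨i, hi0⟩))) (e₂ ⟨j, hj2⟩)
          rwa [hX₂₁, Matrix.toBlocks₂₁, Matrix.of_apply] at this
      · have hj2 : c j = 2 := by omega
        rw [hF1 i hi1, hF2 j hj2]
        have := congrFun (congrFun hX0 (Sum.inl (e₁ ⟨i, hi1⟩))) (e₂ ⟨j, hj2⟩)
        rwa [hX₂₁, Matrix.toBlocks₂₁, Matrix.of_apply] at this
  -- the conjugated matrix in tower coordinates
  have htot : Matrix.reindex (F.trans G) (F.trans G) (D * P * A * (D * P)⁻¹) =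
      Matrix.reindex eL eL (Matrix.fromBlocks (Q₂ * X₁₁ * Q₂⁻¹)
        (Matrix.reindex (Equiv.refl (Fin a₂)) G₂ (Q₂ * X₁₂ * Matrix.fromBlocks (1 : Matrix (Fin 3) (Fin 3) ℂ) 0 0 Q₀⁻¹))
        (Matrix.reindex G₂ (Equiv.refl (Fin a₂)) (Matrix.fromBlocks (1 : Matrix (Fin 3) (Fin 3) ℂ) 0 0 Q₀ * X₂₁ * Q₂⁻¹))
        (Matrix.reindex eR eR (Matrix.fromBlocks (Matrix.reindex (finCongr h3) (finCongr h3) Y₁₁)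
          (Matrix.reindex (finCongr h3) (Equiv.refl (Fin a₀)) (Y₁₂ * Q₀⁻¹))
          (Matrix.reindex (Equiv.refl (Fin a₀)) (finCongr h3) (Q₀ * Y₂₁))
          (Q₀ * Y₂₂ * Q₀⁻¹)))) := by
    rw [hconj, reindex_trans_eq F G, hFconj, hXb, blockDiag_conj, blockDiag_conj]
    simp only [Matrix.one_mul, Matrix.mul_one]
    rw [show G = ((Equiv.refl (Fin a₂)).sumCongr G₂).trans eL from rfl, reindex_trans_eq ((Equiv.refl (Fin a₂)).sumCongr G₂) eL,
      reindex_sumCongr_fromBlocks]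
    rw [show G₂ = ((finCongr h3).sumCongr (Equiv.refl (Fin a₀))).trans eR from rfl,
      reindex_trans_eq ((finCongr h3).sumCongr (Equiv.refl (Fin a₀))) eR, reindex_sumCongr_fromBlocks]
    rfl
  rw [htot, reindex_fromBlocks_mem_towerHull_iff_left hL I, reindex_fromBlocks_mem_towerHull_iff I, mem_towerHull_zero_zero,
    midBlock_zero_zero_reindex h3, hlow, hX₁₁e, hY₁₁e, hY₂₂e]
  -- compare the two lists of conditions
  constructor
  · rintro ⟨⟨hX0, hY0⟩, hup₀, hI, hup₂⟩
    refine ⟨hup₂, ?_, ⟨hI, ?_, hup₀⟩⟩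
    · rw [hX0, Matrix.mul_zero, Matrix.zero_mul]; ext i j; rfl
    · rw [hY0, Matrix.mul_zero]; ext i j; rfl
  · rintro ⟨hup₂, hX0, hI, hY0, hup₀⟩
    refine ⟨⟨?_, ?_⟩, hup₀, hI, hup₂⟩
    · -- `E * X₂₁ * Q₂⁻¹ = 0` with `E`, `Q₂` invertible
      have h0 : Matrix.fromBlocks (1 : Matrix (Fin 3) (Fin 3) ℂ) 0 0 Q₀ * X₂₁ * Q₂⁻¹ = 0 := by
        have := congrArg (Matrix.reindex G₂.symm (Equiv.refl (Fin a₂))) hX0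
        simpa using this
      have : X₂₁ = Matrix.fromBlocks (1 : Matrix (Fin 3) (Fin 3) ℂ) 0 0 Q₀⁻¹ *
          (Matrix.fromBlocks (1 : Matrix (Fin 3) (Fin 3) ℂ) 0 0 Q₀ * X₂₁ * Q₂⁻¹) * Q₂ := by
        rw [← Matrix.mul_assoc, ← Matrix.mul_assoc, hE'E, Matrix.one_mul, Matrix.mul_assoc, Matrix.nonsing_inv_mul _ hQ₂det, Matrix.mul_one]
      rw [this, h0, Matrix.mul_zero, Matrix.zero_mul]
    · have h0 : Q₀ * Y₂₁ = 0 := by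
        have := congrArg (Matrix.reindex (Equiv.refl (Fin a₀)) (finCongr h3).symm) hY0
        simpa using this
      have : Y₂₁ = Q₀⁻¹ * (Q₀ * Y₂₁) := by rw [← Matrix.mul_assoc, Matrix.nonsing_inv_mul _ hQ₀det, Matrix.one_mul]
      rw [this, h0, Matrix.mul_zero]

end Summit.ValiantsHypothesis.ValiantsHypothesis.Theorems.GrenetZeon.HeavyTopCodimOneClassification

end
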